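import Literature.NumberTheory.EllipticCurves.Rank1Residual.X11RankOneCertificates.Claim
import Mathlib.Data.Nat.Prime.Basic
import HarnessLib

/-!
# X11 at rank one beyond `p = 3` — two instance hypotheses of the record theorems DISCHARGED by the recheck

HONEST FRAMING (cell `b2b-bsdres`, verbatim): prove what is provable now; shrink each hard class to its
core with data; no claim beyond stated classes; the cell deletes COMBINATION-shaped classes from
PUBLISHED theorems only, the CONSTRUCTION-shaped remainder is typed; this is not "finishing BSD".

Theorems only. The headline theorems `bsdp_of_claims{1,2}` (files `RecordsN20000Part{1,2}.lean`) and the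
dispatcher `Record.bsdp_of_claim` (`Claim.lean`) carry three instance binders for the record `r`:
`[Fact r.p.Prime]`, `[r.curve.IsElliptic]`, `[r.curve.IsGloballyMinimal]`. The first two FOLLOW from a
passing recheck `r.check = true` and are proved here: `Record.prime_of_check` (the trial division
`isPrimeBelow504100` of `Schema.lean` is a correct primality test below `710² = 504100`:
`prime_of_isPrimeBelow504100`) and `Record.isElliptic_of_check` (the recheck recomputes
`Δ(ainvs) ≠ 0`, and `Δ` of `r.curve` IS that integer: `Record.Δ_curve_of_eq`). Hence the sharper forms
`Record.bsdp_of_claim'` and `bsdp_of_certified_of_claims'` whose only instance hypothesis is global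
minimality of Cremona's model (not decidable from the tree's definition without Tate's algorithm in the
kernel; re-verified outside the kernel by engines Y and P of unit `b2b-bsdres-x11c`). Nothing about the
class X11 changes; per pair.

References: J. E. Cremona, *Algorithms for Modular Elliptic Curves* §3.1 (the invariants) [Cremona1997];
J. H. Silverman, *AEC* III.1 [SilvermanAEC2009].
-/

set_option autoImplicit false

namespace Literature.NumberTheory.EllipticCurves.Rank1Residual.X11RankOneCertificates

/-- **Trial division below `710` is a primality proof below `710² = 504100`**: if `2 ≤ q < 504100` and no
`d ∈ [2, 710)` with `d < q` divides `q`, then `q` is prime (the least prime factor of a composite `q` is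
`≤ √q < 710`). [folklore] -/
theorem prime_of_isPrimeBelow504100 {q : ℕ} (h : isPrimeBelow504100 q = true) : q.Prime := by
  simp only [isPrimeBelow504100, Bool.and_eq_true, decide_eq_true_eq, List.all_eq_true,
    List.mem_range] at h
  obtain ⟨⟨h2, hlt⟩, hall⟩ := h
  by_contra hnp
  have hq1 : q ≠ 1 := by omega
  have hmp : q.minFac.Prime := Nat.minFac_prime hq1
  have hmdvd : q.minFac ∣ q := Nat.minFac_dvd q
  have hm2 : 2 ≤ q.minFac := hmp.two_le
  have hsq : q.minFac ^ 2 ≤ q := Nat.minFac_sq_le_self (by omega) hnp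
  have hm710 : q.minFac < 710 := by
    by_contra hge
    push Not at hge
    have : 710 ^ 2 ≤ q.minFac ^ 2 := Nat.pow_le_pow_left hge 2
    omega
  rcases hall q.minFac hm710 with h | h | h
  · omega
  · have hmle : q.minFac ≤ q := Nat.le_of_dvd (by omega) hmdvd
    exact hnp (le_antisymm hmle h ▸ hmp)
  · exact h (Nat.mod_eq_zero_of_dvd hmdvd)

namespace Record

variable (r : Record)

/-- A certified record's `p` is prime (the recheck ran `isPrimeBelow504100 r.p`). [folklore] -/
theorem prime_of_check (hc : r.check = true) : r.p.Prime := by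
  have h' := r.checkReduction_of_check hc
  simp only [Record.checkReduction, Bool.and_eq_true, decide_eq_true_eq] at h'
  exact prime_of_isPrimeBelow504100 h'.1.1.1.1.1.1.2

/-- The record's curve when the a-invariants are `[a₁,a₂,a₃,a₄,a₆]`. [folklore] -/
theorem curve_of_eq {r : Record} {a1 a2 a3 a4 a6 : ℤ} (h : r.ainvs = [a1, a2, a3, a4, a6]) :
    r.curve = ⟨a1, a2, a3, a4, a6⟩ := by
  simp only [Record.curve, h]

/-- The discriminant of the record's curve IS the integer `discOf` recomputed by the recheck
(Silverman *AEC* III.1: `Δ = −b₂²b₈ − 8b₄³ − 27b₆² + 9b₂b₄b₆`). [cite: SilvermanAEC2009, III.1 (p. 42)] -/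
theorem Δ_curve_of_eq {r : Record} {a1 a2 a3 a4 a6 : ℤ} (h : r.ainvs = [a1, a2, a3, a4, a6]) :
    r.curve.Δ = ((discOf [a1, a2, a3, a4, a6] : ℤ) : ℚ) := by
  rw [curve_of_eq h]
  simp only [WeierstrassCurve.Δ, WeierstrassCurve.b₂, WeierstrassCurve.b₄, WeierstrassCurve.b₆,
    WeierstrassCurve.b₈, discOf, invariants]
  push_cast
  ring

/-- A certified record's curve is an elliptic curve: the recheck found five a-invariants and
`Δ(ainvs) ≠ 0`, and `Δ(r.curve)` is that integer. [folklore] -/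
theorem isElliptic_of_check (hc : r.check = true) : r.curve.IsElliptic := by
  have hs : r.checkSupport = true := by
    simp only [Record.check, Bool.and_eq_true] at hc
    exact hc.1.1.1.1.1
  simp only [Record.checkSupport, Bool.and_eq_true, decide_eq_true_eq, beq_iff_eq] at hs
  obtain ⟨⟨⟨⟨⟨hlen, -⟩, -⟩, -⟩, -⟩, hne⟩ := hs
  rcases hA : r.ainvs with _ | ⟨a1, _ | ⟨a2, _ | ⟨a3, _ | ⟨a4, _ | ⟨a6, _ | ⟨x, t⟩⟩⟩⟩⟩⟩ <;>
    simp [hA] at hlen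
  refine ⟨?_⟩
  rw [Δ_curve_of_eq hA, isUnit_iff_ne_zero]
  rw [hA] at hne
  exact_mod_cast hne

/-- **Sharper dispatcher**: `BSD(E,p)` for a certified record's curve from the inputs and the claim,
with `Fact r.p.Prime` and `r.curve.IsElliptic` DISCHARGED by the recheck; the one remaining instance
hypothesis is global minimality of the (Cremona) model. [folklore] -/
theorem bsdp_of_claim' (I : Inputs) (hc : r.check = true) [r.curve.IsGloballyMinimal] (h : r.Claim) :
    BSDp r.curve r.p := by
  haveI : Fact r.p.Prime := ⟨r.prime_of_check hc⟩
  haveI : r.curve.IsElliptic := r.isElliptic_of_check hc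
  exact r.bsdp_of_claim I hc h

end Record

/-- **Sharper list form**: for a `Certified` list of records whose claims hold, `BSD(E,p)` for every
listed pair, assuming only global minimality of the record's model. Applies verbatim to
`certified_records1`/`certified_records2` (85 pairs, `N < 2·10⁴`). [folklore] -/
theorem bsdp_of_certified_of_claims' (I : Inputs) {rs : List Record} (hC : Certified rs)
    (hcl : Claims rs) (r : Record) (hr : r ∈ rs) [r.curve.IsGloballyMinimal] : BSDp r.curve r.p :=
  r.bsdp_of_claim' I (hC.check_of_mem hr) (hcl r hr)

end Literature.NumberTheory.EllipticCurves.Rank1Residual.X11RankOneCertificates
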